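import Literature.Analysis.FluidPDE.ScalarFourierDefs
import Mathlib.Analysis.Calculus.SmoothSeries
import Mathlib.Analysis.Normed.Group.FunctionSeries
import HarnessLib

/-!
# Coefficient families on the lattice `ℤ^d`: weights, convolution bounds, closure properties

Analysis/FluidPDE proof file, second of the files discharging
`Literature.Analysis.FluidPDE.Torus.exists_unique_isClassicalScalarTransportForcedOn`
(classical well-posedness of `∂ₜθ + u·∇θ = κΔθ + s` on `[0,T] × T^d`; Krylov 1996, Thm. 9.2.3
for the printed statement; objects in `ScalarFourierDefs`). Everything here is elementary
bookkeeping on the frequency lattice `d → ℤ` with the sup norm `‖m‖ = maxᵢ |mᵢ|`, the series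
twin of `NSFourierWeights` / `NSFourierBilinear` / `NSFourierFamily`:

* lattice weights: `(1 + |m|²)^{#d} ≤ (1 + #d)^{#d} (1 + ‖m‖)^{2#d}`, hence
  `∑ₘ (1 + ‖m‖)^{-2#d} < ∞` (`summable_latWeight`, from the tree's
  `Torus.summable_inv_one_add_freqNormSq_pow_card`), translation invariance of the weight mass,
  `‖k‖ ≤ ‖latticeVec k‖`, `|k|² = ‖latticeVec k‖²`;
* the **mixed-weight bound for the lattice convolution** `‖(f ⋆ g)(k)‖ ≤ 2^K latMass
  (A B₀ + A₀ B)(1+‖k‖)^{-K}` (`norm_lconv_le_mixed`, Peetre's inequality through the tree's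
  `FourierNS.norm_mul_norm_le_mixed`), linearity and parametric continuity of `lconv`, the
  derivative symbol `2πi mⱼ` and the **decay of the transport symbol** `N(U, c)` (one order lost
  on `c`, `hasDecay_transportSym`);
* closure of coefficient families `IsCoeffFamily T n W` under shifts, sums, symbols of
  polynomial growth, finite sums; **one-sided differentiation under lattice sums**
  (`hasDerivWithinAt_tsum_Icc`: Mathlib's `hasDerivAt_tsum` applied to the tangent-line
  extensions `FourierNS.icExtend`), the **Leibniz family** of the lattice convolution of two
  families, the transport family and the bootstrap right-hand side `bootRHS`.

## Mathlib search

`hasDerivAt_tsum`, `continuous_tsum`, `continuousOn_tsum`, `tsum_of_norm_bounded`,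
`Summable.of_norm_bounded`, `Equiv.hasSum_iff` (`Equiv.subLeft`), `Finset.sum_choose_succ_mul`,
`pi_norm_le_iff_of_nonneg`, `norm_le_pi_norm`. Mathlib has no weighted-`ℓ^∞` convolution
algebra on `ℤ^d` (searched `lconv`, `discrete convolution`, `Summable.*convolution`).

## References

* N. V. Krylov, *Lectures on Elliptic and Parabolic Equations in Hölder Spaces*, GSM 12, AMS
  1996, Thm. 9.2.3. [Krylov1996]
* L. Grafakos, *Classical Fourier Analysis*, 3rd ed. (2014), §3.3.1. [Grafakos2014]
* P. G. Lemarié-Rieusset, *The Navier–Stokes problem in the 21st century*, CRC 2016, §8.5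
  (weighted sup-norm estimates on the Fourier side).
-/

noncomputable section

open MeasureTheory Real Set Filter UnitAddTorus
open scoped Topology RealInnerProductSpace

namespace Literature.Analysis.FluidPDE

namespace ScalarFourier

open FourierNS (HasDecay clamp icExtend)
open Literature.Analysis.FunctionSpaces.Torus (freqNormSq)

variable {d : Type*} [Fintype d]

/-! ### Lattice weights: comparison with `|k|²` and summability -/

section Weights

/-- Coordinates are bounded by the sup norm: `|mᵢ| ≤ ‖m‖` on `ℤ^d`. [folklore] -/
theorem abs_apply_le_norm (m : d → ℤ) (i : d) : |(m i : ℝ)| ≤ ‖m‖ := by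
  have h := norm_le_pi_norm m i
  rwa [Int.norm_eq_abs] at h

/-- `|m|² ≤ #d · ‖m‖²` (Euclidean length against sup norm). [folklore] -/
theorem freqNormSq_le_card_mul (m : d → ℤ) :
    freqNormSq m ≤ Fintype.card d * ‖m‖ ^ 2 := by
  unfold FunctionSpaces.Torus.freqNormSq
  calc ∑ i, (m i : ℝ) ^ 2 ≤ ∑ _i : d, ‖m‖ ^ 2 := Finset.sum_le_sum fun i _ => by
        have h := abs_apply_le_norm m i
        have h0 : 0 ≤ |(m i : ℝ)| := abs_nonneg _
        calc (m i : ℝ) ^ 2 = |(m i : ℝ)| ^ 2 := (sq_abs _).symm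
          _ ≤ ‖m‖ ^ 2 := pow_le_pow_left₀ h0 h 2
    _ = Fintype.card d * ‖m‖ ^ 2 := by simp

/-- `(1 + |m|²)^c ≤ (1 + c)^c (1 + ‖m‖)^{2c}` with `c = #d`. [folklore] -/
theorem one_add_freqNormSq_pow_le (m : d → ℤ) :
    (1 + freqNormSq m) ^ Fintype.card d ≤
      (1 + (Fintype.card d : ℝ)) ^ Fintype.card d * (1 + ‖m‖) ^ latOrder d := by
  have hc : (0 : ℝ) ≤ Fintype.card d := Nat.cast_nonneg _
  have h0 : 0 ≤ ‖m‖ := norm_nonneg m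
  have h1 : 1 + freqNormSq m ≤ (1 + Fintype.card d) * (1 + ‖m‖) ^ 2 := by
    have := freqNormSq_le_card_mul m
    nlinarith
  have h2 : 0 ≤ 1 + freqNormSq m := by linarith [FunctionSpaces.Torus.freqNormSq_nonneg m]
  calc (1 + freqNormSq m) ^ Fintype.card d
      ≤ ((1 + Fintype.card d) * (1 + ‖m‖) ^ 2) ^ Fintype.card d := pow_le_pow_left₀ h2 h1 _
    _ = (1 + (Fintype.card d : ℝ)) ^ Fintype.card d * (1 + ‖m‖) ^ latOrder d := by
        rw [mul_pow, ← pow_mul, latOrder]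

/-- `|k|² = ‖latticeVec k‖²`: the frequency weight is the squared Euclidean length of the
lattice vector. [folklore] -/
theorem freqNormSq_eq_norm_latticeVec_sq [DecidableEq d] (k : d → ℤ) :
    freqNormSq k = ‖FunctionSpaces.Torus.latticeVec k‖ ^ 2 := by
  rw [EuclideanSpace.real_norm_sq_eq, FunctionSpaces.Torus.freqNormSq]
  simp

/-- The sup norm of a frequency is at most the Euclidean length of its lattice vector:
`‖k‖ ≤ ‖latticeVec k‖`. [folklore] -/
theorem norm_le_norm_latticeVec [DecidableEq d] (k : d → ℤ) :
    ‖k‖ ≤ ‖FunctionSpaces.Torus.latticeVec k‖ := by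
  refine (pi_norm_le_iff_of_nonneg (norm_nonneg _)).2 fun i => ?_
  rw [Int.norm_eq_abs]
  have h := FourierNS.abs_apply_le_norm (FunctionSpaces.Torus.latticeVec k) i
  rwa [FunctionSpaces.Torus.latticeVec_apply] at h

/-- **Summability of the lattice weights**: `∑ₘ (1 + ‖m‖)^{-2#d} < ∞` (comparison with
`∑ₖ (1 + |k|²)^{-#d} < ∞`, tree `Torus.summable_inv_one_add_freqNormSq_pow_card`). [folklore] -/
theorem summable_latWeight : Summable fun m : d → ℤ => ((1 + ‖m‖) ^ latOrder d)⁻¹ := by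
  have hS := (FunctionSpaces.Torus.summable_inv_one_add_freqNormSq_pow_card (d := d)).mul_left
    ((1 + (Fintype.card d : ℝ)) ^ Fintype.card d)
  refine Summable.of_nonneg_of_le (fun m => by positivity) (fun m => ?_) hS
  have hpos : 0 < (1 + freqNormSq m) ^ Fintype.card d :=
    pow_pos (by linarith [FunctionSpaces.Torus.freqNormSq_nonneg m]) _
  have hpos' : 0 < (1 + ‖m‖) ^ latOrder d := by positivity
  rw [← div_eq_mul_inv, le_div_iff₀ hpos, inv_mul_eq_div, div_le_iff₀ hpos']
  exact one_add_freqNormSq_pow_le m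

/-- The lattice weight mass is the sum of the weights. [folklore] -/
theorem hasSum_latWeight : HasSum (fun m : d → ℤ => ((1 + ‖m‖) ^ latOrder d)⁻¹) (latMass d) :=
  summable_latWeight.hasSum

/-- `0 ≤ latMass d`. [folklore] -/
theorem latMass_nonneg : 0 ≤ latMass d :=
  tsum_nonneg fun m => by positivity

/-- Translation invariance: `∑ₘ (1 + ‖k - m‖)^{-2#d} = latMass d`. [folklore] -/
theorem hasSum_latWeight_sub (k : d → ℤ) :
    HasSum (fun m : d → ℤ => ((1 + ‖k - m‖) ^ latOrder d)⁻¹) (latMass d) := by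
  have h := (Equiv.subLeft k).hasSum_iff (f := fun m : d → ℤ => ((1 + ‖m‖) ^ latOrder d)⁻¹)
    (a := latMass d)
  exact h.2 hasSum_latWeight

/-- A coefficient sequence with decay of the summable order is absolutely summable. [folklore] -/
theorem summable_norm_of_hasDecay {K : ℕ} {C : ℝ} {f : (d → ℤ) → ℂ} (hK : latOrder d ≤ K)
    (hf : HasDecay K C f) : Summable fun m => ‖f m‖ :=
  Summable.of_nonneg_of_le (fun _ => norm_nonneg _) (fun m => (hf.of_le hK) m)
    (summable_latWeight.mul_left C)

/-- A coefficient sequence with decay of the summable order is summable. [folklore] -/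
theorem summable_of_hasDecay {K : ℕ} {C : ℝ} {f : (d → ℤ) → ℂ} (hK : latOrder d ≤ K)
    (hf : HasDecay K C f) : Summable f :=
  (summable_norm_of_hasDecay hK hf).of_norm

end Weights

/-! ### Bounds for the lattice convolution and the transport symbol -/

section Conv

variable {K : ℕ} {A₀ A B₀ B M : ℝ} {f g g₁ g₂ f₁ f₂ : (d → ℤ) → ℂ}

/-- Pointwise mixed-weight domination of the convolution family (Peetre's inequality, tree
`FourierNS.norm_mul_norm_le_mixed`). [folklore] -/
theorem norm_lconv_term_le_mixed (hA : 0 ≤ A) (hB : 0 ≤ B) (hf₀ : HasDecay (latOrder d) A₀ f)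
    (hf : HasDecay K A f) (hg₀ : HasDecay (latOrder d) B₀ g) (hg : HasDecay K B g)
    (k m : d → ℤ) :
    ‖f m * g (k - m)‖ ≤ 2 ^ K * ((1 + ‖k‖) ^ K)⁻¹ *
      (A * B₀ * ((1 + ‖k - m‖) ^ latOrder d)⁻¹ + A₀ * B * ((1 + ‖m‖) ^ latOrder d)⁻¹) := by
  rw [norm_mul]
  exact FourierNS.norm_mul_norm_le_mixed hA hB (hf₀ m) (hf m) (hg₀ (k - m)) (hg (k - m))

/-- The sum of the mixed-weight dominating family. [folklore] -/
theorem hasSum_mixedBound (A₀ A B₀ B : ℝ) (K : ℕ) (k : d → ℤ) :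
    HasSum (fun m : d → ℤ => 2 ^ K * ((1 + ‖k‖) ^ K)⁻¹ *
      (A * B₀ * ((1 + ‖k - m‖) ^ latOrder d)⁻¹ + A₀ * B * ((1 + ‖m‖) ^ latOrder d)⁻¹))
      (2 ^ K * latMass d * (A * B₀ + A₀ * B) * ((1 + ‖k‖) ^ K)⁻¹) := by
  have h := (((hasSum_latWeight_sub k).mul_left (A * B₀)).add
    (hasSum_latWeight.mul_left (A₀ * B))).mul_left (2 ^ K * ((1 + ‖k‖) ^ K)⁻¹)
  have heq : 2 ^ K * ((1 + ‖k‖) ^ K)⁻¹ * (A * B₀ * latMass d + A₀ * B * latMass d) =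
      2 ^ K * latMass d * (A * B₀ + A₀ * B) * ((1 + ‖k‖) ^ K)⁻¹ := by ring
  rw [heq] at h
  exact h

/-- Summability of the convolution family for `f` of the summable order and `g` bounded. [folklore] -/
theorem summable_lconv_term (hf : HasDecay (latOrder d) A f) (hg : ∀ m, ‖g m‖ ≤ M) (k : d → ℤ) :
    Summable fun m => f m * g (k - m) := by
  refine Summable.of_norm_bounded ((summable_latWeight (d := d)).mul_left (A * M)) fun m => ?_
  rw [norm_mul]
  have hM : 0 ≤ M := (norm_nonneg _).trans (hg 0)
  calc ‖f m‖ * ‖g (k - m)‖ ≤ A * ((1 + ‖m‖) ^ latOrder d)⁻¹ * M :=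
        mul_le_mul (hf m) (hg _) (norm_nonneg _) (mul_nonneg hf.nonneg (by positivity))
    _ = A * M * ((1 + ‖m‖) ^ latOrder d)⁻¹ := by ring

/-- **Mixed-weight convolution estimate on the lattice**: if `f`, `g` decay to the summable
order `2#d` (constants `A₀`, `B₀`) and to order `K` (constants `A`, `B`), then
`‖(f ⋆ g)(k)‖ ≤ 2^K · latMass · (A B₀ + A₀ B) (1 + ‖k‖)^{-K}` — the bound is *linear* in the
order-`K` constants (series twin of `FourierNS.norm_integral_le_of_mixed`;
Lemarié-Rieusset 2016, §8.5). [folklore] -/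
theorem norm_lconv_le_mixed (hA : 0 ≤ A) (hB : 0 ≤ B) (hf₀ : HasDecay (latOrder d) A₀ f)
    (hf : HasDecay K A f) (hg₀ : HasDecay (latOrder d) B₀ g) (hg : HasDecay K B g) (k : d → ℤ) :
    ‖lconv f g k‖ ≤ 2 ^ K * latMass d * (A * B₀ + A₀ * B) * ((1 + ‖k‖) ^ K)⁻¹ :=
  tsum_of_norm_bounded (hasSum_mixedBound A₀ A B₀ B K k)
    (norm_lconv_term_le_mixed hA hB hf₀ hf hg₀ hg k)

/-- The convolution of two sequences with decay of orders `2#d` and `K` decays to order `K`. [folklore] -/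
theorem hasDecay_lconv_mixed (hA : 0 ≤ A) (hB : 0 ≤ B) (hf₀ : HasDecay (latOrder d) A₀ f)
    (hf : HasDecay K A f) (hg₀ : HasDecay (latOrder d) B₀ g) (hg : HasDecay K B g) :
    HasDecay K (2 ^ K * latMass d * (A * B₀ + A₀ * B)) (lconv f g) := fun k =>
  norm_lconv_le_mixed hA hB hf₀ hf hg₀ hg k

/-- The convolution of two sequences with decay of the summable order decays to that order. [folklore] -/
theorem hasDecay_lconv (hf : HasDecay (latOrder d) A f) (hg : HasDecay (latOrder d) B g) :
    HasDecay (latOrder d) (2 ^ latOrder d * latMass d * (A * B + A * B)) (lconv f g) :=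
  hasDecay_lconv_mixed hf.nonneg hg.nonneg hf hf hg hg

omit [Fintype d] in
/-- Additivity of `lconv` in the second argument (summable families). [folklore] -/
theorem lconv_add_right (k : d → ℤ) (h₁ : Summable fun m => f m * g₁ (k - m))
    (h₂ : Summable fun m => f m * g₂ (k - m)) :
    lconv f (fun m => g₁ m + g₂ m) k = lconv f g₁ k + lconv f g₂ k := by
  simp only [lconv_apply, mul_add]
  exact h₁.tsum_add h₂

omit [Fintype d] in
/-- Subtraction in the second argument of `lconv` (summable families). [folklore] -/
theorem lconv_sub_right (k : d → ℤ) (h₁ : Summable fun m => f m * g₁ (k - m))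
    (h₂ : Summable fun m => f m * g₂ (k - m)) :
    lconv f (fun m => g₁ m - g₂ m) k = lconv f g₁ k - lconv f g₂ k := by
  simp only [lconv_apply, mul_sub]
  exact h₁.tsum_sub h₂

omit [Fintype d] in
/-- Additivity of `lconv` in the first argument (summable families). [folklore] -/
theorem lconv_add_left (k : d → ℤ) (h₁ : Summable fun m => f₁ m * g (k - m))
    (h₂ : Summable fun m => f₂ m * g (k - m)) :
    lconv (fun m => f₁ m + f₂ m) g k = lconv f₁ g k + lconv f₂ g k := by
  simp only [lconv_apply, add_mul]
  exact h₁.tsum_add h₂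

omit [Fintype d] in
/-- Scalars come out of the second argument of `lconv`. [folklore] -/
theorem lconv_const_mul_right (c : ℂ) (f g : (d → ℤ) → ℂ) (k : d → ℤ) :
    lconv f (fun m => c * g m) k = c * lconv f g k := by
  simp only [lconv_apply, ← tsum_mul_left]
  congr 1 with m
  ring

omit [Fintype d] in
/-- Scalars come out of the first argument of `lconv`. [folklore] -/
theorem lconv_const_mul_left (c : ℂ) (f g : (d → ℤ) → ℂ) (k : d → ℤ) :
    lconv (fun m => c * f m) g k = c * lconv f g k := by
  simp only [lconv_apply, ← tsum_mul_left]
  congr 1 with m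
  ring

omit [Fintype d] in
/-- `lconv 0 g = 0`. [folklore] -/
@[simp]
theorem lconv_zero_left (g : (d → ℤ) → ℂ) (k : d → ℤ) : lconv (fun _ => 0) g k = 0 := by
  simp [lconv_apply]

omit [Fintype d] in
/-- `lconv f 0 = 0`. [folklore] -/
@[simp]
theorem lconv_zero_right (f : (d → ℤ) → ℂ) (k : d → ℤ) : lconv f (fun _ => 0) k = 0 := by
  simp [lconv_apply]

/-- **Continuity of a parametrised lattice convolution**: if `F x`, `G x` are continuous in the
parameter at each frequency, `F x` decays to the summable order uniformly and `G x` is bounded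
uniformly, then `x ↦ (F x ⋆ G x)(k)` is continuous (Mathlib `continuous_tsum`). [folklore] -/
theorem continuous_lconv_param {X : Type*} [TopologicalSpace X] {F G : X → (d → ℤ) → ℂ}
    (hF : ∀ m, Continuous fun x => F x m) (hG : ∀ m, Continuous fun x => G x m)
    (hFd : ∀ x, HasDecay (latOrder d) A (F x)) (hGb : ∀ x m, ‖G x m‖ ≤ M) (k : d → ℤ) :
    Continuous fun x => lconv (F x) (G x) k := by
  simp only [lconv_apply]
  rcases isEmpty_or_nonempty X with hX | ⟨⟨x₀⟩⟩
  · exact continuous_of_discreteTopology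
  have hA : 0 ≤ A := (hFd x₀).nonneg
  have hM : 0 ≤ M := (norm_nonneg _).trans (hGb x₀ 0)
  refine continuous_tsum (fun m => (hF m).mul (hG (k - m)))
    ((summable_latWeight (d := d)).mul_left (A * M)) fun m x => ?_
  rw [norm_mul]
  calc ‖F x m‖ * ‖G x (k - m)‖ ≤ A * ((1 + ‖m‖) ^ latOrder d)⁻¹ * M :=
        mul_le_mul (hFd x m) (hGb x _) (norm_nonneg _) (by positivity)
    _ = A * M * ((1 + ‖m‖) ^ latOrder d)⁻¹ := by ring

/-- Continuity on a set of a parametrised lattice convolution (Mathlib `continuousOn_tsum`). [folklore] -/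
theorem continuousOn_lconv_param {X : Type*} [TopologicalSpace X] {s : Set X}
    {F G : X → (d → ℤ) → ℂ} (hF : ∀ m, ContinuousOn (fun x => F x m) s)
    (hG : ∀ m, ContinuousOn (fun x => G x m) s) (hA : 0 ≤ A)
    (hFd : ∀ x ∈ s, HasDecay (latOrder d) A (F x)) (hGb : ∀ x ∈ s, ∀ m, ‖G x m‖ ≤ M)
    (k : d → ℤ) : ContinuousOn (fun x => lconv (F x) (G x) k) s := by
  simp only [lconv_apply]
  refine continuousOn_tsum (fun m => (hF m).mul (hG (k - m)))
    ((summable_latWeight (d := d)).mul_left (A * M)) fun m x hx => ?_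
  rw [norm_mul]
  calc ‖F x m‖ * ‖G x (k - m)‖ ≤ A * ((1 + ‖m‖) ^ latOrder d)⁻¹ * M :=
        mul_le_mul (hFd x hx m) (hGb x hx _) (norm_nonneg _) (by positivity)
    _ = A * M * ((1 + ‖m‖) ^ latOrder d)⁻¹ := by ring

/-! #### The derivative symbol and the transport symbol -/

omit [Fintype d] in
/-- `dsym j (-m) = -dsym j m`. [folklore] -/
theorem dsym_neg (j : d) (m : d → ℤ) : dsym j (-m) = -dsym j m := by
  simp [dsym_apply]

/-- The derivative symbol has linear growth: `‖2πi mⱼ‖ ≤ 2π ‖m‖`. [folklore] -/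
theorem norm_dsym_le (j : d) (m : d → ℤ) : ‖dsym j m‖ ≤ 2 * π * ‖m‖ := by
  rw [dsym_apply, norm_mul, norm_mul, norm_mul, Complex.norm_I, Complex.norm_real,
    Complex.norm_two, Real.norm_of_nonneg Real.pi_pos.le, mul_one, Complex.norm_intCast]
  exact mul_le_mul_of_nonneg_left (abs_apply_le_norm m j) (by positivity)

/-- `‖2πi mⱼ‖ ≤ 2π (1 + ‖m‖)¹` (polynomial growth of order one). [folklore] -/
theorem norm_dsym_le_growth (j : d) (m : d → ℤ) : ‖dsym j m‖ ≤ 2 * π * (1 + ‖m‖) ^ 1 := by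
  refine (norm_dsym_le j m).trans ?_
  rw [pow_one]
  exact mul_le_mul_of_nonneg_left (by linarith [norm_nonneg m]) (by positivity)

/-- Multiplication by the derivative symbol costs one order of decay. [folklore] -/
theorem hasDecay_dsym_mul {X : ℝ} {c : (d → ℤ) → ℂ} (hc : HasDecay (K + 1) X c) (j : d) :
    HasDecay K (2 * π * X) (fun m => dsym j m * c m) :=
  hc.mul_linear (by positivity) (norm_dsym_le j)

/-- **Decay of the transport symbol**: if the drift coefficients decay to orders `2#d`, `K`
and the scalar coefficients to orders `2#d + 1`, `K + 1`, then `N(U, c)` decays to order `K`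
(one derivative is lost on `c`). [folklore] -/
theorem hasDecay_transportSym {U : d → (d → ℤ) → ℂ} {c : (d → ℤ) → ℂ} {X₀ X : ℝ}
    (hU₀ : ∀ j, HasDecay (latOrder d) A₀ (U j)) (hU : ∀ j, HasDecay K A (U j)) (hA : 0 ≤ A)
    (hc₀ : HasDecay (latOrder d + 1) X₀ c) (hc : HasDecay (K + 1) X c) (hX : 0 ≤ X) :
    HasDecay K (Fintype.card d *
      (2 ^ K * latMass d * (A * (2 * π * X₀) + A₀ * (2 * π * X)))) (transportSym U c) := by
  have h : ∀ j ∈ (Finset.univ : Finset d), HasDecay K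
      (2 ^ K * latMass d * (A * (2 * π * X₀) + A₀ * (2 * π * X)))
      (lconv (U j) (fun m => dsym j m * c m)) := fun j _ =>
    hasDecay_lconv_mixed hA (by positivity) (hU₀ j) (hU j) (hasDecay_dsym_mul hc₀ j)
      (hasDecay_dsym_mul hc j)
  intro k
  have h2 := FourierNS.hasDecay_finset_sum Finset.univ h k
  rw [Finset.sum_const, Finset.card_univ, nsmul_eq_mul] at h2
  rw [transportSym_apply]
  exact h2

/-- The transport symbol is linear in the scalar coefficients: differences. [folklore] -/
theorem transportSym_sub {U : d → (d → ℤ) → ℂ} {c₁ c₂ : (d → ℤ) → ℂ} {X₁ X₂ : ℝ}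
    (hU : ∀ j, HasDecay (latOrder d) A (U j)) (hc₁ : HasDecay (latOrder d + 1) X₁ c₁)
    (hc₂ : HasDecay (latOrder d + 1) X₂ c₂) (k : d → ℤ) :
    transportSym U c₁ k - transportSym U c₂ k = transportSym U (fun m => c₁ m - c₂ m) k := by
  simp only [transportSym_apply, ← Finset.sum_sub_distrib]
  refine Finset.sum_congr rfl fun j _ => ?_
  have h₁ := summable_lconv_term (g := fun m => dsym j m * c₁ m) (hU j)
    (hasDecay_dsym_mul hc₁ j).norm_le k
  have h₂ := summable_lconv_term (g := fun m => dsym j m * c₂ m) (hU j)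
    (hasDecay_dsym_mul hc₂ j).norm_le k
  rw [← lconv_sub_right (g₁ := fun m => dsym j m * c₁ m) (g₂ := fun m => dsym j m * c₂ m) k h₁ h₂]
  simp only [mul_sub]

/-- Continuity in a parameter of the transport symbol. [folklore] -/
theorem continuous_transportSym_param {Y : Type*} [TopologicalSpace Y] {U : Y → d → (d → ℤ) → ℂ}
    {c : Y → (d → ℤ) → ℂ} {X : ℝ} (hU : ∀ j m, Continuous fun y => U y j m)
    (hc : ∀ m, Continuous fun y => c y m) (hUd : ∀ y j, HasDecay (latOrder d) A (U y j))
    (hcd : ∀ y, HasDecay (latOrder d + 1) X (c y)) (k : d → ℤ) :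
    Continuous fun y => transportSym (U y) (c y) k := by
  simp only [transportSym_apply]
  refine continuous_finsetSum _ fun j _ => ?_
  exact continuous_lconv_param (F := fun y => U y j) (G := fun y m => dsym j m * c y m)
    (hU j) (fun m => continuous_const.mul (hc m)) (fun y => hUd y j)
    (fun y m => (hasDecay_dsym_mul (hcd y) j).norm_le m) k

end Conv

/-! ### Coefficient families: closure properties -/

section Family

variable {T : ℝ} {n : ℕ} {W W' F G : ℕ → ℝ → (d → ℤ) → ℂ}

/-- Restriction to fewer derivatives. [folklore] -/
theorem IsCoeffFamily.mono (h : IsCoeffFamily T n W) {m : ℕ} (hm : m ≤ n) :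
    IsCoeffFamily T m W where
  decay i hi := h.decay i (hi.trans hm)
  cont i hi := h.cont i (hi.trans hm)
  deriv i hi := h.deriv i (lt_of_lt_of_le hi hm)

/-- **Shift**: the family of `∂ₜ W₀ = W₁`. [folklore] -/
theorem IsCoeffFamily.shift (h : IsCoeffFamily T (n + 1) W) :
    IsCoeffFamily T n (fun i => W (i + 1)) where
  decay i hi := h.decay (i + 1) (by omega)
  cont i hi := h.cont (i + 1) (by omega)
  deriv i hi := h.deriv (i + 1) (by omega)

/-- Sums of families. [folklore] -/
theorem IsCoeffFamily.add (h : IsCoeffFamily T n W) (h' : IsCoeffFamily T n W') :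
    IsCoeffFamily T n (fun i t m => W i t m + W' i t m) where
  decay i hi K := by
    obtain ⟨C, hC⟩ := h.decay i hi K
    obtain ⟨C', hC'⟩ := h'.decay i hi K
    exact ⟨C + C', fun t ht => (hC t ht).add (hC' t ht)⟩
  cont i hi m := (h.cont i hi m).add (h'.cont i hi m)
  deriv i hi m t ht := (h.deriv i hi m t ht).add (h'.deriv i hi m t ht)

/-- Negation. [folklore] -/
theorem IsCoeffFamily.neg (h : IsCoeffFamily T n W) :
    IsCoeffFamily T n (fun i t m => -W i t m) where
  decay i hi K := by
    obtain ⟨C, hC⟩ := h.decay i hi K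
    exact ⟨C, fun t ht => (hC t ht).neg⟩
  cont i hi m := (h.cont i hi m).neg
  deriv i hi m t ht := (h.deriv i hi m t ht).neg

/-- Differences. [folklore] -/
theorem IsCoeffFamily.sub (h : IsCoeffFamily T n W) (h' : IsCoeffFamily T n W') :
    IsCoeffFamily T n (fun i t m => W i t m - W' i t m) := by
  simpa [sub_eq_add_neg] using h.add h'.neg

/-- **Multiplication by a time-independent symbol of polynomial growth** (`2πi mⱼ` for
`∂ⱼ`, `-νₘ` for `κΔ`). [folklore] -/
theorem IsCoeffFamily.symbol (h : IsCoeffFamily T n W) {σ : (d → ℤ) → ℂ} {g : ℕ} {M : ℝ}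
    (hM : 0 ≤ M) (hgrowth : ∀ m, ‖σ m‖ ≤ M * (1 + ‖m‖) ^ g) :
    IsCoeffFamily T n (fun i t m => σ m * W i t m) where
  decay i hi K := by
    obtain ⟨C, hC⟩ := h.decay i hi (K + g)
    exact ⟨M * C, fun t ht => (hC t ht).mul_growth hM hgrowth⟩
  cont i hi m := continuousOn_const.mul (h.cont i hi m)
  deriv i hi m t ht := by
    simpa using (h.deriv i hi m t ht).const_mul (σ m)

/-- Constant multiples. [folklore] -/
theorem IsCoeffFamily.const_mul (h : IsCoeffFamily T n W) (c : ℂ) :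
    IsCoeffFamily T n (fun i t m => c * W i t m) :=
  h.symbol (σ := fun _ => c) (g := 0) (norm_nonneg c) (fun m => by simp)

/-- The derivative-symbol family `2πi mⱼ Wᵢ(t, m)` of a family is a family. [folklore] -/
theorem IsCoeffFamily.dsym (h : IsCoeffFamily T n W) (j : d) :
    IsCoeffFamily T n (fun i t m => dsym j m * W i t m) :=
  h.symbol (g := 1) (by positivity) (norm_dsym_le_growth j)

/-- Finite sums of families. [folklore] -/
theorem IsCoeffFamily.finset_sum {β : Type*} (s : Finset β)
    {Wf : β → ℕ → ℝ → (d → ℤ) → ℂ} (h : ∀ b ∈ s, IsCoeffFamily T n (Wf b)) :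
    IsCoeffFamily T n (fun i t m => ∑ b ∈ s, Wf b i t m) := by
  classical
  induction s using Finset.induction_on with
  | empty =>
    exact { decay := fun i hi K => ⟨0, fun t ht m => by simp⟩
            cont := fun i hi m => by simpa using continuousOn_const
            deriv := fun i hi m t ht => by simpa using hasDerivWithinAt_const t (Icc 0 T) (0:ℂ) }
  | insert b s hb ih =>
    have h1 := (h b (Finset.mem_insert_self b s)).add
      (ih fun b' hb' => h b' (Finset.mem_insert_of_mem hb'))
    simpa [Finset.sum_insert hb] using h1

/-- A uniform-in-time decay constant of order `K` for `W i`, `i ≤ n`, as a function of `i`. [folklore] -/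
theorem IsCoeffFamily.decay' (h : IsCoeffFamily T n W) (K : ℕ) :
    ∃ C : ℕ → ℝ, ∀ i ≤ n, 0 ≤ C i ∧ ∀ t ∈ Icc 0 T, HasDecay K (C i) (W i t) := by
  classical
  have : ∀ i, ∃ C : ℝ, i ≤ n → 0 ≤ C ∧ ∀ t ∈ Icc 0 T, HasDecay K C (W i t) := fun i => by
    by_cases hi : i ≤ n
    · obtain ⟨C, hC⟩ := h.decay i hi K
      exact ⟨max C 0, fun _ => ⟨le_max_right _ _, fun t ht => (hC t ht).mono (le_max_left _ _)⟩⟩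
    · exact ⟨0, fun h' => absurd h' hi⟩
  choose C hC using this
  exact ⟨C, hC⟩

/-- A nonnegative uniform-in-time decay constant of order `K` for `W i`. [folklore] -/
theorem IsCoeffFamily.decay_nonneg (h : IsCoeffFamily T n W) {i : ℕ} (hi : i ≤ n) (K : ℕ) :
    ∃ C : ℝ, 0 ≤ C ∧ ∀ t ∈ Icc 0 T, HasDecay K C (W i t) := by
  obtain ⟨C, hC⟩ := h.decay' K
  exact ⟨C i, hC i hi⟩

/-! #### One-sided differentiation under lattice sums; the Leibniz family -/

omit [Fintype d] in
/-- **Differentiation under the lattice sum within `[0, T]`.** If `F t m` has derivative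
`F' t m` within `[0, T]` at every `t ∈ [0, T]` for every frequency `m`, with
`‖F' t m‖ ≤ u m` on `[0, T]`, `∑ u < ∞`, and `∑ₘ F t₀ m` converges, then
`t ↦ ∑ₘ F t m` has derivative `∑ₘ F' t₀ m` within `[0, T]` at `t₀` (Mathlib's two-sided
`hasDerivAt_tsum` applied to the tangent-line extensions `FourierNS.icExtend`). [folklore] -/
theorem hasDerivWithinAt_tsum_Icc (hT : 0 < T) {F F' : ℝ → (d → ℤ) → ℂ} {u : (d → ℤ) → ℝ}
    (hu : Summable u) (h_bound : ∀ t ∈ Icc 0 T, ∀ m, ‖F' t m‖ ≤ u m)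
    (h_diff : ∀ m, ∀ t ∈ Icc 0 T, HasDerivWithinAt (F · m) (F' t m) (Icc 0 T) t)
    {t₀ : ℝ} (ht₀ : t₀ ∈ Icc 0 T) (h0 : Summable (F t₀ ·)) :
    HasDerivWithinAt (fun t => ∑' m, F t m) (∑' m, F' t₀ m) (Icc 0 T) t₀ := by
  set G : (d → ℤ) → ℝ → ℂ := fun m t => icExtend T (F · m) (F' · m) t with hG
  have hGd : ∀ m t, HasDerivAt (G m) (F' (clamp T t) m) t := fun m t =>
    FourierNS.hasDerivAt_icExtend hT (h_diff m) t
  have hG' : ∀ m t, ‖F' (clamp T t) m‖ ≤ u m := fun m t =>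
    h_bound _ (FourierNS.clamp_mem_Icc hT.le t) m
  have hGF : ∀ t ∈ Icc 0 T, ∀ m, G m t = F t m := fun t ht m => by
    simp only [hG, FourierNS.icExtend_of_mem ht]
  have hG0 : Summable fun m => G m t₀ := h0.congr fun m => (hGF t₀ ht₀ m).symm
  have h := hasDerivAt_tsum hu hGd hG' hG0 t₀
  rw [FourierNS.clamp_of_mem ht₀] at h
  refine h.hasDerivWithinAt.congr (fun t ht => ?_) ?_
  · exact tsum_congr fun m => (hGF t ht m).symm
  · exact tsum_congr fun m => (hGF t₀ ht₀ m).symm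

/-- A uniform bound of a family member on `[0, T]` (order-zero decay). [folklore] -/
theorem IsCoeffFamily.exists_norm_le (h : IsCoeffFamily T n W) {i : ℕ} (hi : i ≤ n) :
    ∃ C : ℝ, 0 ≤ C ∧ ∀ t ∈ Icc 0 T, ∀ m, ‖W i t m‖ ≤ C := by
  obtain ⟨C, hC0, hC⟩ := h.decay_nonneg hi 0
  exact ⟨C, hC0, fun t ht m => (hC t ht).norm_le m⟩

/-- **Derivative of the lattice convolution of two families within `[0, T]`**:
`∂ₜ (Fᵢ ⋆ Gⱼ) = Fᵢ₊₁ ⋆ Gⱼ + Fᵢ ⋆ Gⱼ₊₁` for `i, j < n`. [folklore] -/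
theorem IsCoeffFamily.hasDerivWithinAt_lconv (hT : 0 < T) (hF : IsCoeffFamily T n F)
    (hG : IsCoeffFamily T n G) {i j : ℕ} (hi : i < n) (hj : j < n) (k : d → ℤ)
    {t : ℝ} (ht : t ∈ Icc 0 T) :
    HasDerivWithinAt (fun s => lconv (F i s) (G j s) k)
      (lconv (F (i + 1) t) (G j t) k + lconv (F i t) (G (j + 1) t) k) (Icc 0 T) t := by
  obtain ⟨A, hA0, hA⟩ := hF.decay_nonneg hi.le (latOrder d)
  obtain ⟨A₁, hA₁0, hA₁⟩ := hF.decay_nonneg (Nat.succ_le_of_lt hi) (latOrder d)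
  obtain ⟨B, hB0, hB⟩ := hG.exists_norm_le hj.le
  obtain ⟨B₁, hB₁0, hB₁⟩ := hG.exists_norm_le (Nat.succ_le_of_lt hj)
  set Φ : ℝ → (d → ℤ) → ℂ := fun s m => F i s m * G j s (k - m) with hΦ
  set Φ' : ℝ → (d → ℤ) → ℂ := fun s m =>
    F (i + 1) s m * G j s (k - m) + F i s m * G (j + 1) s (k - m) with hΦ'
  have h_bound : ∀ s ∈ Icc 0 T, ∀ m, ‖Φ' s m‖ ≤ (A₁ * B + A * B₁) * ((1 + ‖m‖) ^ latOrder d)⁻¹ := by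
    intro s hs m
    have h1 : ‖F (i + 1) s m * G j s (k - m)‖ ≤ A₁ * ((1 + ‖m‖) ^ latOrder d)⁻¹ * B := by
      rw [norm_mul]
      exact mul_le_mul (hA₁ s hs m) (hB s hs _) (norm_nonneg _) (by positivity)
    have h2 : ‖F i s m * G (j + 1) s (k - m)‖ ≤ A * ((1 + ‖m‖) ^ latOrder d)⁻¹ * B₁ := by
      rw [norm_mul]
      exact mul_le_mul (hA s hs m) (hB₁ s hs _) (norm_nonneg _) (by positivity)
    calc ‖Φ' s m‖ ≤ ‖F (i + 1) s m * G j s (k - m)‖ + ‖F i s m * G (j + 1) s (k - m)‖ :=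
          norm_add_le _ _
      _ ≤ A₁ * ((1 + ‖m‖) ^ latOrder d)⁻¹ * B + A * ((1 + ‖m‖) ^ latOrder d)⁻¹ * B₁ :=
          add_le_add h1 h2
      _ = (A₁ * B + A * B₁) * ((1 + ‖m‖) ^ latOrder d)⁻¹ := by ring
  have h_diff : ∀ m, ∀ s ∈ Icc 0 T, HasDerivWithinAt (Φ · m) (Φ' s m) (Icc 0 T) s := by
    intro m s hs
    exact (hF.deriv i hi m s hs).mul (hG.deriv j hj (k - m) s hs)
  have h0 : Summable (Φ t ·) := summable_lconv_term (g := G j t) (hA t ht) (hB t ht) k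
  have h := hasDerivWithinAt_tsum_Icc hT ((summable_latWeight (d := d)).mul_left _) h_bound
    h_diff ht h0
  have hs1 : Summable fun m => F (i + 1) t m * G j t (k - m) :=
    summable_lconv_term (g := G j t) (hA₁ t ht) (hB t ht) k
  have hs2 : Summable fun m => F i t m * G (j + 1) t (k - m) :=
    summable_lconv_term (g := G (j + 1) t) (hA t ht) (hB₁ t ht) k
  have heq : (∑' m, Φ' t m) = lconv (F (i + 1) t) (G j t) k + lconv (F i t) (G (j + 1) t) k := by
    rw [lconv_apply, lconv_apply, ← hs1.tsum_add hs2]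
  rw [heq] at h
  exact h

/-- Continuity in time on `[0, T]` of the lattice convolution of two families. [folklore] -/
theorem IsCoeffFamily.continuousOn_lconv (hF : IsCoeffFamily T n F) (hG : IsCoeffFamily T n G)
    {i j : ℕ} (hi : i ≤ n) (hj : j ≤ n) (k : d → ℤ) :
    ContinuousOn (fun s => lconv (F i s) (G j s) k) (Icc 0 T) := by
  obtain ⟨A, hA0, hA⟩ := hF.decay_nonneg hi (latOrder d)
  obtain ⟨B, -, hB⟩ := hG.exists_norm_le hj
  exact continuousOn_lconv_param (F := fun s => F i s) (G := fun s => G j s) (hF.cont i hi)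
    (hG.cont j hj) hA0 hA hB k

/-- **Leibniz rule**: the Leibniz family of two families is a family
(`∂ₜ Lᵢ = Lᵢ₊₁` by `Finset.sum_choose_succ_mul`). [folklore] -/
theorem IsCoeffFamily.leibniz (hT : 0 < T) (hF : IsCoeffFamily T n F) (hG : IsCoeffFamily T n G) :
    IsCoeffFamily T n (leibnizFamily F G) := by
  refine ⟨fun i hi K => ?_, fun i hi m => ?_, fun i hi m t ht => ?_⟩
  · -- decay of order `K`
    obtain ⟨A₀, hA₀⟩ := hF.decay' (latOrder d)
    obtain ⟨A, hA⟩ := hF.decay' K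
    obtain ⟨B₀, hB₀⟩ := hG.decay' (latOrder d)
    obtain ⟨B, hB⟩ := hG.decay' K
    refine ⟨∑ l ∈ Finset.range (i + 1), ‖(i.choose l : ℂ)‖ *
      (2 ^ K * latMass d * (A l * B₀ (i - l) + A₀ l * B (i - l))), fun t ht => ?_⟩
    refine FourierNS.hasDecay_finset_sum _ fun l hl => ?_
    have hl' : l ≤ n := (Nat.lt_succ_iff.1 (Finset.mem_range.1 hl)).trans hi
    have hil : i - l ≤ n := by omega
    exact (hasDecay_lconv_mixed (hA l hl').1 (hB (i - l) hil).1 ((hA₀ l hl').2 t ht)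
      ((hA l hl').2 t ht) ((hB₀ (i - l) hil).2 t ht) ((hB (i - l) hil).2 t ht)).const_mul _
  · -- continuity in time
    change ContinuousOn (fun t => ∑ l ∈ Finset.range (i + 1),
      (i.choose l : ℂ) * lconv (F l t) (G (i - l) t) m) (Icc 0 T)
    refine continuousOn_finsetSum _ fun l hl => ?_
    have hl' : l ≤ n := (Nat.lt_succ_iff.1 (Finset.mem_range.1 hl)).trans hi
    exact continuousOn_const.mul (hF.continuousOn_lconv hG hl' (by omega) m)
  · -- the derivative: Leibniz
    have hderiv : HasDerivWithinAt (fun s => leibnizFamily F G i s m)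
        (∑ l ∈ Finset.range (i + 1), (i.choose l : ℂ) *
          (lconv (F (l + 1) t) (G (i - l) t) m + lconv (F l t) (G (i - l + 1) t) m)) (Icc 0 T) t := by
      refine HasDerivWithinAt.fun_sum fun l hl => ?_
      have hl' : l ≤ i := Nat.lt_succ_iff.1 (Finset.mem_range.1 hl)
      exact (hF.hasDerivWithinAt_lconv hT hG (by omega) (by omega) m ht).const_mul _
    convert hderiv using 1
    change ∑ l ∈ Finset.range (i + 1 + 1), ((i + 1).choose l : ℂ) *
      lconv (F l t) (G (i + 1 - l) t) m = _
    have h := Finset.sum_choose_succ_mul (fun a b => lconv (F a t) (G b t) m) i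
    rw [show i + 1 + 1 = i + 2 from rfl, h, add_comm, ← Finset.sum_add_distrib]
    refine Finset.sum_congr rfl fun l hl => ?_
    have hl' : l ≤ i := Nat.lt_succ_iff.1 (Finset.mem_range.1 hl)
    rw [Nat.sub_add_comm hl', mul_add]

/-- **The transport family of families is a family.** [folklore] -/
theorem IsCoeffFamily.transportFamily (hT : 0 < T) {UF : d → ℕ → ℝ → (d → ℤ) → ℂ}
    (hU : ∀ j, IsCoeffFamily T n (UF j)) (hW : IsCoeffFamily T n W) :
    IsCoeffFamily T n (transportFamily UF W) :=
  IsCoeffFamily.finset_sum _ fun j _ => (hU j).leibniz hT (hW.dsym j)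

/-- The heat symbol `-νₖ` has quadratic growth: `‖-νₖ‖ ≤ 4π²κ #d (1 + ‖k‖)²`. [folklore] -/
theorem norm_heatRate_le {κ : ℝ} (hκ : 0 ≤ κ) (k : d → ℤ) :
    ‖(-(heatRate κ k : ℂ))‖ ≤ 4 * π ^ 2 * κ * Fintype.card d * (1 + ‖k‖) ^ 2 := by
  rw [norm_neg, Complex.norm_real, heatRate_apply,
    Real.norm_of_nonneg (by have := FunctionSpaces.Torus.freqNormSq_nonneg k; positivity)]
  have h1 := freqNormSq_le_card_mul k
  have h2 : ‖k‖ ^ 2 ≤ (1 + ‖k‖) ^ 2 := by nlinarith [norm_nonneg k]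
  have hc : (0 : ℝ) ≤ Fintype.card d := Nat.cast_nonneg _
  calc 4 * π ^ 2 * κ * freqNormSq k ≤ 4 * π ^ 2 * κ * (Fintype.card d * ‖k‖ ^ 2) := by gcongr
    _ ≤ 4 * π ^ 2 * κ * (Fintype.card d * (1 + ‖k‖) ^ 2) := by gcongr
    _ = 4 * π ^ 2 * κ * Fintype.card d * (1 + ‖k‖) ^ 2 := by ring

/-- **The bootstrap right-hand side of families is a family**: `-νₖ Wᵢ + SFᵢ - Nᵢ` is a family of
order `n` when `W`, `SF`, `UF ⱼ` are. [folklore] -/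
theorem IsCoeffFamily.bootRHS (hT : 0 < T) {κ : ℝ} (hκ : 0 ≤ κ)
    {UF : d → ℕ → ℝ → (d → ℤ) → ℂ} {SF : ℕ → ℝ → (d → ℤ) → ℂ}
    (hU : ∀ j, IsCoeffFamily T n (UF j)) (hS : IsCoeffFamily T n SF) (hW : IsCoeffFamily T n W) :
    IsCoeffFamily T n (bootRHS κ UF SF W) :=
  ((hW.symbol (σ := fun k => -(heatRate κ k : ℂ)) (g := 2) (by positivity)
    (norm_heatRate_le hκ)).add hS).sub (hW.transportFamily hT hU)

end Family

end ScalarFourier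

end Literature.Analysis.FluidPDE

end
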